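import Literature.NumberTheory.Automorphic.RankinSelbergTorusEulerLimit
import Literature.NumberTheory.Automorphic.SmoothedFormCentralCharacter
import Literature.NumberTheory.Automorphic.RankinSelbergTowerFiniteness
import Literature.NumberTheory.Automorphic.AutomorphicConjugate
import Literature.NumberTheory.Automorphic.CuspidalWhittakerGL2
import HarnessLib

/-!
# `Ψ(s; W_φ, W̄_φ, Φ) = L^{S'}(s, π × π̃) · Ψ_{S'}(s)` for the Whittaker coefficient of a cusp form

Topic `NumberTheory/Automorphic`; namespace `Literature.NumberTheory.Automorphic`. Proof file (theorems
only). The abstract Euler factorisation of the unfolded Rankin–Selberg integral at a complex point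
(`rankinSelbergTorusIntegralC_eq_mul_setIntegral_of_hasProd`, `RankinSelbergTorusEulerLimit`) is
instantiated for the datum of the printed proof (Jacquet–Shalika (1981), §4–§5; Cogdell (2004), §2.3):
`W = W_φ` the global Whittaker coefficient of `φ = invQuot (S_η f)`, `f ∈ π` cuspidal, and
`Φ = Φ_∞ ⊗ 𝟙_{𝒪̂ⁿ}` a standard test function. Its hypotheses are discharged by the tree:

* `W_φ` is an unramified Whittaker–Hecke datum with parameters the Satake parameters at every good place
  (`exists_isTorusUnramifiedAt_whittakerCoeff_smoothedForm`), `‖W_φ‖` is invariant under the centre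
  (`whittakerCoeff_scalar_mul` with the central character, `SmoothedFormCentralCharacter`), `Φ` is
  spherical, `≥ 0` and supported on integral rows;
* the complex integrand is integrable as soon as the real integral at `re s` is finite, the real torus
  sums `T_v(q_v^{-re s})` are then finite (`exists_prod_schurSelfSum_le_of_cuspidal`), and the local
  factors `P_{α_v, ᾱ_v}(q_v^{-s})⁻¹` multiply to `L^{S'}(s, α ⊗ ᾱ) = partialPairL S' α ᾱ s` for `re s > 1`
  (`hasProd_partialPairL` with `JacquetShalika1981_multipliable_partialPairL_holds`).

Main result: `rankinSelbergTorusIntegralC_whittakerCoeff_eq_partialPairL_mul` — for `re s > 1`, with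
`Ψ(re s) < ∞` and a positive unit-box integral,
`Ψ(s; W_φ, W̄_φ, Φ) = L^{S'}(s, α ⊗ ᾱ) · ∫_{B({v ∉ S'}) × K} I_s`.

## References

* H. Jacquet, J. A. Shalika, *On Euler products and the classification of automorphic
  representations I*, Amer. J. Math. 103 (1981), §4, Thm. (5.3) proof [JacquetShalikaAJM1981].
* J. W. Cogdell, *Analytic theory of L-functions for GL_n*, in *An Introduction to the Langlands
  Program* (2004), §2.3 Thm. 2.2, §3 Thm. 3.3 [CogdellAnalyticTheory2004].
-/

noncomputable section

open MeasureTheory Measure NumberField IsDedekindDomain Matrix Set Filter Finset Topology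
open scoped MatrixGroups ENNReal NNReal ComplexConjugate Pointwise
open Literature.RingTheory.SymmetricFunctions.SymmPoly
open Literature.NumberTheory.GaloisRepresentations (ideleGroup localUnits)

namespace Literature.NumberTheory.Automorphic

/-! ### The Whittaker coefficient and the centre -/

section Scalar

variable {n : ℕ} {K : Type} [Field K] [NumberField K]
variable [MeasurableSpace ↥(adelicUnipotent n K)] {ν : Measure ↥(adelicUnipotent n K)}
  {𝓕 : Set ↥(adelicUnipotent n K)} {ψ : AddChar (AdeleRing (𝓞 K) K) Circle}

/-- **The Whittaker coefficient inherits the behaviour of `φ` under the centre**: if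
`φ((z 1_n) g) = c φ(g)` for all `g`, then `W_φ((z 1_n) g) = c W_φ(g)` (`z 1_n` commutes with `N_n(𝔸)`).
[folklore] -/
theorem whittakerCoeff_scalar_mul {φ : GL (Fin n) (AdeleRing (𝓞 K) K) → ℂ} {z : ideleGroup K} {c : ℂ}
    (hφ : ∀ g, φ (Matrix.GeneralLinearGroup.scalar (Fin n) z * g) = c * φ g)
    (g : GL (Fin n) (AdeleRing (𝓞 K) K)) :
    whittakerCoeff ν 𝓕 ψ φ (Matrix.GeneralLinearGroup.scalar (Fin n) z * g) = c * whittakerCoeff ν 𝓕 ψ φ g := by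
  unfold whittakerCoeff
  have h : ∀ u : ↥(adelicUnipotent n K),
      φ ((u : GL (Fin n) (AdeleRing (𝓞 K) K)) * (Matrix.GeneralLinearGroup.scalar (Fin n) z * g)) *
          conj (whittakerCharFun ψ u) =
        c * (φ ((u : GL (Fin n) (AdeleRing (𝓞 K) K)) * g) * conj (whittakerCharFun ψ u)) := by
    intro u
    rw [← mul_assoc, ← Matrix.GeneralLinearGroup.scalar_commute z (u : GL (Fin n) (AdeleRing (𝓞 K) K)),
      mul_assoc, hφ, mul_assoc]
  simp_rw [h]
  rw [integral_const_mul, mul_smul_comm]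

end Scalar

/-! ### The Euler factorisation for the Whittaker coefficient of a cusp form -/

section Cuspidal

open ValuativeRel

variable {n : ℕ} {K : Type} [Field K] [NumberField K]
  {μ : Measure (AdelicGroupData.gl n K).automorphicQuotient} [(AdelicGroupData.gl n K).IsAutomorphicMeasure μ]
variable [MeasurableSpace ↥(adelicUnipotent n K)] [BorelSpace ↥(adelicUnipotent n K)]
  [MeasurableConstSMul ↥(rationalUnipotent n K) ↥(adelicUnipotent n K)]
  {ν : Measure ↥(adelicUnipotent n K)} [IsFiniteMeasureOnCompacts ν]
  [SMulInvariantMeasure ↥(rationalUnipotent n K) ↥(adelicUnipotent n K) ν] [ν.IsMulRightInvariant]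
  {𝓕 : Set ↥(adelicUnipotent n K)} {ψ : AddChar (AdeleRing (𝓞 K) K) Circle}
variable [MeasurableSpace (ideleGroup K)] [BorelSpace (ideleGroup K)]

-- the house local instances of `RankinSelbergTorusIntegral` (Borel structures of `GL_n(𝔸_K)` in both
-- spellings, second countability of `𝔸_Kˣ`); none overrides a Mathlib instance
attribute [local instance] adelicBorel borelSpace_adelic locallyCompactSpace_adelic
  secondCountableTopology_gl_adelic secondCountableTopology_ideleGroup glAdeleBorel borelSpace_glAdele

omit [MeasurableSpace ↥(adelicUnipotent n K)] [BorelSpace ↥(adelicUnipotent n K)]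
  [MeasurableConstSMul ↥(rationalUnipotent n K) ↥(adelicUnipotent n K)] in
/-- **Measurability of the complex torus integrand** for continuous `W` and `Φ` with `g ↦ Φ(e_n g)`
measurable (the variant of `measurable_torusIntegrandC` of `RankinSelbergTorusPairEuler` with the
hypotheses in the shape produced by `continuous_whittakerCoeff`). [folklore] -/
theorem measurable_torusIntegrandC_of_continuous {W : GL (Fin n) (AdeleRing (𝓞 K) K) → ℂ} (hW : Continuous W)
    {Φ : (Fin n → AdeleRing (𝓞 K) K) → ℝ}
    (hΦm : Measurable fun g : GL (Fin n) (AdeleRing (𝓞 K) K) => Φ (lastRow n K g)) (s : ℂ) :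
    Measurable (torusIntegrandC n K W Φ s) := by
  haveI : SecondCountableTopology (GL (Fin n) (AdeleRing (𝓞 K) K)) :=
    secondCountableTopology_generalLinearGroup_adeleRing K (Fin n)
  haveI : SecondCountableTopology (AdelicGroupData.gl n K).Adelic :=
    secondCountableTopology_generalLinearGroup_adeleRing K (Fin n)
  haveI : SecondCountableTopology ↥(maximalCompactAdelic n K) := TopologicalSpace.Subtype.secondCountableTopology _
  unfold torusIntegrandC
  have hpt : Measurable (torusPoint n K) := continuous_torusPoint.measurable
  refine (Complex.measurable_ofReal.comp (((hW.measurable.comp hpt).norm.pow_const 2).mul (hΦm.comp hpt))).mul ?_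
  -- the complex torus weight is measurable
  have hw : Measurable (torusWeightC n K s) := by
    unfold torusWeightC
    refine Finset.measurable_prod _ fun i _ => ?_
    exact (Complex.measurable_ofReal.comp (measurable_coe_nnreal_real.comp
      ((continuous_ideleNorm_holds K).measurable.comp (measurable_pi_apply i)))).pow_const _
  exact hw.comp measurable_fst

/-- **`Ψ(s; W_φ, W̄_φ, Φ) = L^{S'}(s, α ⊗ ᾱ) · Ψ_{S'}(s)` on `re s > 1`.** Let `π` be a cuspidal
automorphic representation of `GL_n(𝔸_K)` (`0 < n`) with Satake family `α` off `S`, `f ∈ π`, `η` a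
continuous compactly supported left `K(𝔫₀)`-invariant weight, `φ = invQuot (S_η f)`, `W = W_φ` its
global Whittaker coefficient (fundamental domain `𝓕` of `N_n(K) \ N_n(𝔸)` with compact closure, global
character `ψ`), `Φ = Φ_∞ ⊗ 𝟙_{𝒪̂ⁿ}` with `Φ_∞ ≥ 0` and `g ↦ Φ(e_n g)` measurable, and `S' ⊇ S` a set of
finite places off which `v ∤ 𝔫₀` and `ψ_v` has conductor `𝒪_v`. For `re s > 1`, if the real
unfolded integral `Ψ(re s)` is finite and the unit-box integral over `B({v ∉ S'}) × K` is positive, then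

  `Ψ(s; W, W̄, Φ) = partialPairL S' α ᾱ s · ∫_{B({v ∉ S'}) × K} |W(diag(a) k)|² Φ(e_n diag(a) k) |det a|^s δ_B(a)⁻¹`

— the Euler factorisation of the unfolded global Rankin–Selberg integral of `(φ̄, φ)` into the partial
`L`-function of `π × π̃` (`ᾱ` is the Satake family of `π̃ = π̄`, `IsSatakeFamilyOf.conj`) and its
`S'`-part (Jacquet–Shalika (1981), §4 and Thm. (5.3), proof; Cogdell (2004), Thm. 2.2 with Thm. 3.3).
[cite: JacquetShalikaAJM1981, §2 Prop. (2.3), §4] [cite: CogdellAnalyticTheory2004, Thm. 2.2, Thm. 3.3] -/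
theorem rankinSelbergTorusIntegralC_whittakerCoeff_eq_partialPairL_mul (hn : 0 < n)
    (P : CuspidalAutomorphicRepGL n K μ) {S : Set (HeightOneSpectrum (𝓞 K))} {α : SatakeFamily K}
    (hα : IsSatakeFamilyOf P S α) {𝔫₀ : Ideal (𝓞 K)} (h𝔫₀ : 𝔫₀ ≠ 0)
    {η : (AdelicGroupData.gl n K).Adelic → ℝ} (hη : Continuous η) (hηs : HasCompactSupport η)
    (hηK : ∀ k : (AdelicGroupData.gl n K).Adelic, k ∈ principalCongruenceLevel n K 𝔫₀ →
      ∀ g : (AdelicGroupData.gl n K).Adelic, η (k * g) = η g)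
    (f : P.1.toSubmodule) (h𝓕 : IsFundamentalDomain ↥(rationalUnipotent n K) 𝓕 ν) (h𝓕m : MeasurableSet 𝓕)
    (h𝓕c : IsCompact (closure 𝓕)) (hψ : IsGlobalAddChar K ψ)
    {S' : Set (HeightOneSpectrum (𝓞 K))} (hSS' : S ⊆ S')
    (hGood : ∀ v ∉ S', ¬ v.asIdeal ∣ 𝔫₀ ∧ (∀ c ∈ 𝒪[v.adicCompletion K], ψ.adicComponent v c = 1) ∧
      ∀ ϖ : v.adicCompletion K, Valued.v ϖ = WithZero.exp (-1 : ℤ) →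
        ∃ c ∈ 𝒪[v.adicCompletion K], ψ.adicComponent v (ϖ⁻¹ * c) ≠ 1)
    {x : HeightOneSpectrum (𝓞 K) → Fin n → ℂ}
    (hx : ∀ v ∉ S', (Finset.univ : Finset (Fin n)).val.map (x v) = α v)
    {Φinf : (Fin n → InfiniteAdeleRing K) → ℝ} (hΦinf : ∀ z, 0 ≤ Φinf z)
    (hΦm : Measurable fun g : GL (Fin n) (AdeleRing (𝓞 K) K) => standardTestFun n K Φinf (lastRow n K g))
    (νA : Measure (Fin n → ideleGroup K)) [νA.IsMulLeftInvariant] [SFinite νA]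
    (νK : Measure ↥(maximalCompactAdelic n K)) [SFinite νK] {s : ℂ} (hs : 1 < s.re)
    (hfin : rankinSelbergTorusIntegral n K νA νK
      (whittakerCoeff ν 𝓕 ψ
        (invQuot (AdelicGroupData.gl n K) (smoothedForm η (f : (AdelicGroupData.gl n K).L2 μ))))
      (standardTestFun n K Φinf) s.re ≠ ⊤)
    (hpos : ∫⁻ p in unitBox {v | v ∉ S'} ×ˢ Set.univ, torusIntegrand n K
      (whittakerCoeff ν 𝓕 ψ
        (invQuot (AdelicGroupData.gl n K) (smoothedForm η (f : (AdelicGroupData.gl n K).L2 μ))))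
      (standardTestFun n K Φinf) s.re p ∂(νA.prod νK) ≠ 0) :
    rankinSelbergTorusIntegralC n K νA νK
        (whittakerCoeff ν 𝓕 ψ
          (invQuot (AdelicGroupData.gl n K) (smoothedForm η (f : (AdelicGroupData.gl n K).L2 μ))))
        (standardTestFun n K Φinf) s =
      partialPairL S' α (fun v => (α v).map conj) s *
        ∫ p in unitBox {v | v ∉ S'} ×ˢ Set.univ, torusIntegrandC n K
          (whittakerCoeff ν 𝓕 ψ
            (invQuot (AdelicGroupData.gl n K) (smoothedForm η (f : (AdelicGroupData.gl n K).L2 μ))))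
          (standardTestFun n K Φinf) s p ∂(νA.prod νK) := by
  classical
  set φ : GL (Fin n) (AdeleRing (𝓞 K) K) → ℂ :=
    invQuot (AdelicGroupData.gl n K) (smoothedForm η (f : (AdelicGroupData.gl n K).L2 μ)) with hφ
  set W : GL (Fin n) (AdeleRing (𝓞 K) K) → ℂ := whittakerCoeff ν 𝓕 ψ φ with hWdef
  set Φ : (Fin n → AdeleRing (𝓞 K) K) → ℝ := standardTestFun n K Φinf with hΦdef
  have hGood' : ∀ v ∈ {v : HeightOneSpectrum (𝓞 K) | v ∉ S'}, v ∉ S ∧ ¬ v.asIdeal ∣ 𝔫₀ ∧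
      (∀ c ∈ 𝒪[v.adicCompletion K], ψ.adicComponent v c = 1) ∧
      ∀ ϖ : v.adicCompletion K, Valued.v ϖ = WithZero.exp (-1 : ℤ) →
        ∃ c ∈ 𝒪[v.adicCompletion K], ψ.adicComponent v (ϖ⁻¹ * c) ≠ 1 :=
    fun v hv => ⟨fun h => hv (hSS' h), hGood v hv⟩
  -- the uniformizers of the Satake data at the good places
  have hex : ∀ v ∉ S', ∃ ϖ : (v.adicCompletion K)ˣ, IsTorusUnramifiedAt n K W v ϖ (x v) := fun v hv =>
    exists_isTorusUnramifiedAt_whittakerCoeff_smoothedForm P hα h𝔫₀ (hGood' v hv).1 (hGood v hv).1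
      hη hηs hηK f (hx v hv) h𝓕 h𝓕c hψ (hGood v hv).2.1 (hGood v hv).2.2
  let ϖ : ∀ v : HeightOneSpectrum (𝓞 K), (v.adicCompletion K)ˣ := fun v =>
    if hv : v ∉ S' then Classical.choose (hex v hv) else 1
  have hW : ∀ v ∉ S', IsTorusUnramifiedAt n K W v (ϖ v) (x v) := fun v hv => by
    simp only [ϖ, dif_pos hv]
    exact Classical.choose_spec (hex v hv)
  -- central invariance of `‖W‖`
  obtain ⟨ω, hu, -, -, -, -, hcl⟩ := P.exists_centralCharacter_smoothedForm
  have hWZ : ∀ (z : ideleGroup K) (g : GL (Fin n) (AdeleRing (𝓞 K) K)),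
      ‖W (Matrix.GeneralLinearGroup.scalar (Fin n) z * g)‖ = ‖W g‖ := fun z g => by
    rw [hWdef, whittakerCoeff_scalar_mul (fun g' => hcl η f z g') g, norm_mul, hu z, one_mul]
  -- the test function
  have hΦ0 : ∀ y, 0 ≤ Φ y := standardTestFun_nonneg hΦinf
  have hΦv : ∀ v ∉ S', ∀ y : Fin n → AdeleRing (𝓞 K) K, Φ y ≠ 0 → ∀ j, Valued.v ((y j).2 v) ≤ 1 :=
    fun v _ y hy j => standardTestFun_ne_zero_valued_le_one Φinf hy j
  -- integrability of the complex integrand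
  have hWc : Continuous W := continuous_whittakerCoeff h𝓕m h𝓕c hψ.continuous
    (continuous_invQuot_smoothedForm hη hηs _)
  have hint : Integrable (torusIntegrandC n K W Φ s) (νA.prod νK) :=
    (integrable_torusIntegrandC_iff νA νK hΦ0 (measurable_torusIntegrandC_of_continuous hWc hΦm s).aestronglyMeasurable).2 hfin
  -- finiteness of the real torus sums at `re s`
  obtain ⟨C, hC, hle⟩ := exists_prod_schurSelfSum_le_of_cuspidal P hα h𝔫₀ hη hηs hηK f h𝓕 h𝓕c hψ hGood' hx
    Φinf νA νK hfin hpos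
  have hT : ∀ v ∉ S', schurSelfSum (x v) ((v.residueCard : ℝ) ^ (-s.re)) ≠ ⊤ := fun v hv => by
    have h := hle {v} (by simpa using hv)
    rw [Finset.prod_singleton] at h
    exact ne_top_of_le_ne_top hC h
  -- the Euler product of the local factors
  have hL := hasProd_partialPairL JacquetShalika1981_multipliable_partialPairL_holds P P.conj (hα.mono hSS')
    (hα.mono hSS').conj hs
  exact rankinSelbergTorusIntegralC_eq_mul_setIntegral_of_hasProd νA νK hn hW hWZ
    (fun v _ => isLastRowSphericalAt_standardTestFun Φinf v) hΦv hΦ0 hint hT hx hL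

end Cuspidal

end Literature.NumberTheory.Automorphic
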